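import Summits.RiemannHypothesis.RiemannHypothesis.Theorems.TiltedLandingLaw421R3UnionShadow
import Summits.RiemannHypothesis.RiemannHypothesis.Theorems.TiltedLandingLaw421R3Lens1ToothNest

/-!
# TiltedLandingLaw421R3 — lens-1 (N″a) `ToothNestUmbrellaAQ θ κ₁ d` (TYPED OPEN LAW, qualitative) + (K) glue — IMAGE v1

W-09 lens-1 (rh33346-lens-1 g10).  IMAGE of the scratch of record v4 (director-rh g30 (CA981) PICK (P); C2 rh-idea-2 g57 def CHECK v3/v4 rh-split
STATUS l.9516 ✓; tenure g21 K co-read of `restFactor_of_zeros` PASS l.9536; critic g31 small-model scans of v4 = 0 violations l.9546; C6 rh-idea-4 g45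
exact all-tilt certificate PART 2 l.9628; M+ word director-rh g30 (CA1004)) = `ToothNestUmbrellaA-v4.lean` 87573deede00a54f with the ONE typing change
(CA1004)(b): the class constant `κ₁` and the drift bound `d` are PARAMETERS of the law (instance of record `(θ, 2/5, 3/4)`); imports = the two TREE
modules #1262 `…R3UnionShadow` (tenure's 111) and #1264 `…R3Lens1ToothNest` (lens-1's 112). SUPPORT (K-only): the law is a `def … : Prop`, asserted by
NOTHING here; every theorem is glue or kernel algebra.  No stub is closed by this file.

THE LAW (N″a) `ToothNestUmbrellaAQ θ κ₁ d` — the REST-FACTOR form of «tooth-nest umbrella, small drift» (C2 RESULT-4/4b/6 class RV(κ₁), drift read at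
112's explicit three-body point; INSTANCE OF RECORD `κ₁ = 2/5`, `d = 3/4`): on a legal frame (`EngineHyps5 2 …`), for a top `T` (`0 < Im T`), an
umbrella partner `b` in the θ-band (`(1 − θ)·Im T ≤ Im b ≤ Im T`) touching `T`'s closed disc (`|Re T − Re b| ≤ Im T + Im b`, exactly as in
`RhW08.Lens1PinningTol.UmbrellaLow θ`), a NEAR real tooth `t` (`|t − Re T| ≤ Im T/2`), a rest factor `H` (`RestFactor`: `H` entire and `f⁽ʲ⁾ z =
(z−T)(z−T̄)(z−b)(z−b̄)(z−t)·H z`) of class `RVClass κ₁ T H` (`H ≠ 0` on `D⁺(T) := {(Re z − Re T)² + Im z² ≤ Im T², Im z ≥ Im T/16}` and `Im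
T²·‖(H′/H)′‖ ≤ κ₁` there) with drift `Im T·‖H′(p₃)/H(p₃)‖ ≤ d` at `p₃ T t := ⟨Re T + (t − Re T)/3, √(3·Im T² − (t − Re T)²)/3⟩` (112's nested child of
the pure three-body cubic; `p₃_nested`: `0 < Im p₃`, `p₃ ∈ D⁺(T)`, `NestedStep T p₃`) ⇒ `∃ w, 0 < Im w ∧ f⁽ʲ⁺¹⁾ w = 0 ∧ NestedStep T w` (CLOSED Jensen
disc of `T`, `RhW08.QuadW.NestedStep`; NO depth constant — depth riders are certified-false under drift, C6 RESULT-1 (D) / C2 RESULT-3).  `θ` is free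
in the def; call sites keep `0 ≤ θ < 1` (stub 2′ uses `θ = 1/10`).  SCOPE: `RVClass` demands `H ≠ 0` on `D⁺(T)`, so a second tooth or any other zero
of `f⁽ʲ⁾` inside `D⁺(T)` is OUTSIDE (N″a) (residual R⁗); multi-toucher / strong-drift umbrellas = (N″b), DEFERRED and OPEN, not claimed here.

STATUS OF THE LAW AT THE INSTANCE OF RECORD (2/5, 3/4) = OPEN, with this exact evidence (C6 g45 PART 1 l.9502 / PART 2 l.9628, pure `fractions`,
Sturm/Schur–Cohn, 0 undecided): as typed it has NO counter-configuration anywhere C6 certified — tooth-inserted custody: typed window non-empty on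
226/275 (record, tooth) configurations and NESTED throughout on 226/226; the law's OWN class (one toucher + near tooth, rest field `K ≡ g̃`, so `κ₁ =
0`, drift `= |g̃|`): NESTED on 1298/1298 for `|g̃| ≤ 3/4`, indeed for every `|g̃| < 2.745`.  REACH, said plainly: the class clause is tilt-free and
FAILS on every custody (record, tooth) configuration of record (min `κ₁ = 0.463`; two-toucher frames 0.50–0.55), and the violating records at their
tilts of record have drift 1.77–1.87 > 3/4 — «as typed, (N″a) v4's hypotheses are met by NO custody (record, tooth, g_r) triple while its CONCLUSION
holds on all of them at every tilt |g̃| ≤ 10» (C6): the custody of record is (N″b) on both counts.  The literal `3/4` is the C2-checked certificate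
constant (NK transfer from `p₃` to the true continuation child costs ≤ 0.4 × 0.612; child drift ≤ 1 = the certified fat-slack regime), not the
phenomenon's edge.  The M+ certification of (N″a) on its class is a SEPARATE later object under the director's word; nothing of it is here.

CONTENTS: §1 vocabulary — `DPlus`, `RestFactor`, `RVClass`, the point `p₃` with `p₃_nested`, the law `ToothNestUmbrellaAQ θ κ₁ d : Prop` (OPEN); §2
(K) `succ_of_nearTooth` : (N″a) at ANY `(θ, κ₁, d)` ⇒ an in-class near-tooth umbrella below a level-`j` band state `T` yields `∃ u, StTrkDQ … (j+1) u`
(three lines over tree `RhW08.SuccB.stTrkDQ_succ_of_nested`); §3 (K) `umbrella_dispatch` / `umbrellaLow_dispatch` : the 2′ data (`UmbrellaLow θ`, `¬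
ReadyR2`, range corner) ⇒ by tenure's 111 `unionShadow_trichotomy` + `feet_in_range` (by name): NEAR tooth ∨ FAR tooth in the union shadow ∨ left-foot
sign fails ∨ right-foot sign fails — the first branch is (N″a)'s socket, the other three are the honest residual R⁗ (C2 PRICE (L) §E.3; not typed as
laws here); §4 (K) `peel` and ★ `restFactor_of_zeros` (n1, the glue debt of tenure (23): on a legal frame the rest factor EXISTS from the three zeros
`T`, `b`, `t` with `0 < Im T`, `0 < Im b`, `b ≠ T` — entire level `Literature.Analysis.Complex.differentiable_iteratedDeriv_of_entire`, conjugate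
zeros `Literature.NumberTheory.LFunctions.iteratedDeriv_conj_of_conj` ∘ `apply_conj_eq_conj`, five `dslope` peelings via
`Literature.NumberTheory.LFunctions.BurnolVectors.differentiable_dslope` + `RhW08.NewtonDoor.factor_dslope`).  The corner side condition of §3 (`√j·Hs
+ 3·Hs < (j+2)·R/2`) is discharged for `j ≥ 4` by 111's `corner_of_four_le`; `j ≤ 3` stays with the caller (tenure/C2 notes (n2)). SIZING OF RECORD
UNCHANGED (stub 2′ S as typed; (U)+(N)+(N″a)[+(N″b)]+(K) = CANDIDATE decomposition; registry v14q′ untouched). HONEST LABEL: (N″a) is an OPEN typed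
law; §2–§4 are K bookkeeping and kernel algebra; nothing here bears on the truth of RH; RH is not proved; ⟨33346⟩/⟨33347⟩ OPEN; typed ≠ checked ≠
certified ≠ landed ≠ proved.
-/

noncomputable section

open Complex Set
open scoped ComplexConjugate

namespace RhW08.Lens1ToothNestUmbrella

open RhIdea6.G17.W07C7 RhIdea6.G17.W07C7.Rev6 RhIdea6.G18.W07C8.Law421BirthS RhIdea6.G19.W07C11.Seam
open RhW08.Round1 RhW08.StSwap RhW08.Round2 RhW08.QuadW RhW08.SuccB RhW08.SuccSplit
open RhW08.UnionShadow (footL footR unionShadow_trichotomy feet_in_range)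

/-! ## §1 Vocabulary of the class RV(κ₁) and the law (N″a) -/

/-- `D⁺(T)`: the closed Jensen disc of `T` above height `Im T/16` (C2 RESULT-4/4b (iii)'s domain of the variation bound). -/
def DPlus (T z : ℂ) : Prop := (z.re - T.re) ^ 2 + z.im ^ 2 ≤ T.im ^ 2 ∧ T.im / 16 ≤ z.im

/-- REST FACTOR: `H` is entire and `f⁽ʲ⁾ = (z − T)(z − T̄)(z − b)(z − b̄)(z − t)·H` (so the rest field is `K = H′/H`). -/
def RestFactor (f : ℂ → ℂ) (j : ℕ) (T b : ℂ) (t : ℝ) (H : ℂ → ℂ) : Prop :=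
  Differentiable ℂ H ∧ ∀ z : ℂ, iteratedDeriv j f z = (z - T) * (z - conj T) * (z - b) * (z - conj b) * (z - t) * H z

/-- RV(κ₁) «variation-only» class on `D⁺(T)`: `H ≠ 0` there and `Im T²·‖(H′/H)′‖ ≤ κ₁` (no bound on `‖H′/H‖` itself). -/
def RVClass (κ₁ : ℝ) (T : ℂ) (H : ℂ → ℂ) : Prop :=
  ∀ z : ℂ, DPlus T z → H z ≠ 0 ∧ T.im ^ 2 * ‖deriv (fun w => deriv H w / H w) z‖ ≤ κ₁

/-- The DRIFT READING POINT `p₃ T t := ⟨Re T + (t − Re T)/3, √(3·Im T² − (t − Re T)²)/3⟩` = the explicit upper child `w₊` of 112's three-body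
law (`RhW08.Lens1ToothNest.children_of_near_tooth`; `|p₃ − T| = Im T/√3`, `NestedStep T p₃`); for `|t − Re T| ≤ Im T/2`, `Im p₃ ≥ √11/6·Im T`. -/
def p₃ (T : ℂ) (t : ℝ) : ℂ := ⟨T.re + (t - T.re) / 3, Real.sqrt (3 * T.im ^ 2 - (t - T.re) ^ 2) / 3⟩

/-- The reading point is legal: for `0 < Im T` and `|t − Re T| ≤ Im T/2`, `p₃ T t` lies in `D⁺(T)` (indeed `Im p₃ ≥ Im T/2 > Im T/16` and
`|p₃ − T|² = Im T²/3`), has positive height, and satisfies the CLOSED `NestedStep T (p₃ T t)`. -/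
theorem p₃_nested {T : ℂ} {t : ℝ} (hT : 0 < T.im) (ht : |t - T.re| ≤ T.im / 2) :
    0 < (p₃ T t).im ∧ DPlus T (p₃ T t) ∧ NestedStep T (p₃ T t) := by
  have habs := abs_le.1 ht
  have hτ : (t - T.re) ^ 2 ≤ T.im ^ 2 / 4 := by nlinarith [habs.1, habs.2]
  have hpos : 0 ≤ 3 * T.im ^ 2 - (t - T.re) ^ 2 := by nlinarith
  have hs : Real.sqrt (3 * T.im ^ 2 - (t - T.re) ^ 2) ^ 2 = 3 * T.im ^ 2 - (t - T.re) ^ 2 := Real.sq_sqrt hpos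
  have hsl : T.im * 3 / 2 ≤ Real.sqrt (3 * T.im ^ 2 - (t - T.re) ^ 2) := by
    rw [show T.im * 3 / 2 = Real.sqrt ((T.im * 3 / 2) ^ 2) by rw [Real.sqrt_sq (by positivity)]]
    exact Real.sqrt_le_sqrt (by nlinarith)
  have hre : (p₃ T t).re = T.re + (t - T.re) / 3 := rfl
  have him : (p₃ T t).im = Real.sqrt (3 * T.im ^ 2 - (t - T.re) ^ 2) / 3 := rfl
  have hnorm : ((p₃ T t).re - T.re) ^ 2 + (p₃ T t).im ^ 2 = T.im ^ 2 / 3 := by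
    rw [hre, him]; nlinarith [hs]
  refine ⟨?_, ⟨?_, ?_⟩, ?_⟩
  · rw [him]; nlinarith
  · nlinarith [hnorm]
  · rw [him]; nlinarith
  · unfold NestedStep; nlinarith [hnorm, sq_nonneg ((p₃ T t).re - T.re)]

/-- ★ (N″a) `ToothNestUmbrellaAQ θ κ₁ d` — TYPED OPEN LAW (qualitative; class RV(κ₁), drift `≤ d`; the INSTANCE OF RECORD is
`(θ, κ₁, d) = (θ, 2/5, 3/4)` — director-rh g30 (CA1004)(b): the two literals are PARAMETERS so that class-widening ((N″b)/(N″c)) needs no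
new def; the glue below never uses their values): on a legal frame, an upper zero `T` of
`f⁽ʲ⁾` with an umbrella partner `b` in the height band `[(1−θ)·Im T, Im T]` touching `T`'s closed disc, a TOOTH `t` within `Im T/2` of `Re T`,
rest factor `H` in RV(κ₁) on `D⁺(T)`, and drift `Im T·‖H′/H‖(p₃ T t) ≤ d` at 112's explicit three-body point ⇒ `f⁽ʲ⁺¹⁾` has an UPPER zero in
`T`'s CLOSED Jensen disc.  Evidence at (2/5, 3/4): floats C2 RESULT-3 §2 / RESULT-4/4b; exact C6 RESULT-1 (B) (grid tilts, 18 810/18 810) and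
C6 PART 2 (ALL real tilts |g̃| ≤ 10: tooth-inserted custody typed window NESTED 226/226; own one-toucher class NESTED 1298/1298 for
|g̃| ≤ 3/4; hypotheses met by NO custody triple — see the module docstring).  Asserted nowhere. -/
def ToothNestUmbrellaAQ (θ κ₁ d : ℝ) : Prop :=
  ∀ (η : ℝ) (f : ℂ → ℂ) (x₀ s hmax R Hs : ℝ) (B : ℕ), EngineHyps5 2 η f x₀ s hmax R Hs B →
    ∀ (j : ℕ) (T b : ℂ) (t : ℝ) (H : ℂ → ℂ),
      0 < T.im → (1 - θ) * T.im ≤ b.im → b.im ≤ T.im → |T.re - b.re| ≤ T.im + b.im →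
      |t - T.re| ≤ T.im / 2 →
      RestFactor f j T b t H → RVClass κ₁ T H →
      T.im * ‖deriv H (p₃ T t) / H (p₃ T t)‖ ≤ d →
      ∃ w : ℂ, 0 < w.im ∧ iteratedDeriv (j + 1) f w = 0 ∧ NestedStep T w

/-! ## §2 (K) the glue: (N″a) + a BAND parent ⇒ a level-(j+1) band state -/

/-- ★ (K) `succ_of_nearTooth`: under (N″a), an in-class near-tooth umbrella configuration whose `T` is a level-`j` BAND state yields a
level-(j+1) band state — `RhW08.SuccB.stTrkDQ_succ_of_nested` (…R3SuccNested) with the parent `T`. -/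
theorem succ_of_nearTooth {θ κ₁ d : ℝ} (hN : ToothNestUmbrellaAQ θ κ₁ d)
    {η : ℝ} {f : ℂ → ℂ} {x₀ s hmax R Hs : ℝ} {B j : ℕ} {T b : ℂ} {t : ℝ} {H : ℂ → ℂ}
    (hE : EngineHyps5 2 η f x₀ s hmax R Hs B) (hT : StTrkDQ η f x₀ s hmax R Hs B j T)
    (hb1 : (1 - θ) * T.im ≤ b.im) (hb2 : b.im ≤ T.im) (htouch : |T.re - b.re| ≤ T.im + b.im)
    (hnear : |t - T.re| ≤ T.im / 2)
    (hH : RestFactor f j T b t H) (hRV : RVClass κ₁ T H)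
    (hdrift : T.im * ‖deriv H (p₃ T t) / H (p₃ T t)‖ ≤ d) :
    ∃ u : ℂ, StTrkDQ η f x₀ s hmax R Hs B (j + 1) u := by
  obtain ⟨w, hwim, hw0, hn⟩ := hN η f x₀ s hmax R Hs B hE j T b t H hT.2.2.1 hb1 hb2 htouch hnear hH hRV hdrift
  exact ⟨w, stTrkDQ_succ_of_nested hE hT hw0 hwim hn⟩

/-! ## §3 (K) the dispatcher: where the near-tooth branch sits inside the 2′ data (tenure's 111 by name) -/

/-- ★ (K) `umbrella_dispatch`: on a legal frame with level `j` NOT `ReadyR2` (2′'s binder), a level-`j` band state `T`, a partner `b` touching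
`T`'s closed disc from equal or lower height, and the range corner `√j·Hs + 3·Hs < (j+2)·R/2`, tenure's `unionShadow_trichotomy` +
`feet_in_range` (111) split the configuration four ways: a NEAR tooth (`|t − Re T| ≤ Im T/2` — (N″a)'s socket, §2) ∨ a FAR tooth in the union
shadow ∨ the left-foot dimple sign fails ∨ the right-foot dimple sign fails (the last three = the honest residual R⁗, not typed as a law here). -/
theorem umbrella_dispatch {η : ℝ} {f : ℂ → ℂ} {x₀ s hmax R Hs : ℝ} {B j : ℕ} {T v : ℂ} (b : ℂ)
    (hE : EngineHyps5 2 η f x₀ s hmax R Hs B) (hT : StTrkDQ η f x₀ s hmax R Hs B j T)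
    (hnR : ¬ ReadyR2 η f x₀ s hmax R Hs B j v)
    (hbT : b.im ≤ T.im) (htouch : |T.re - b.re| ≤ T.im + b.im)
    (hcorner : Real.sqrt j * Hs + 3 * Hs < ((j : ℝ) + 2) * R / 2) :
    (∃ t : ℝ, iteratedDeriv j f (t : ℂ) = 0 ∧ |t - T.re| ≤ T.im / 2) ∨
      (∃ t ∈ Icc (footL T b) (footR T b), iteratedDeriv j f (t : ℂ) = 0 ∧ T.im / 2 < |t - T.re|) ∨
      0 ≤ (iteratedDeriv (j + 1) f ((footL T b : ℝ) : ℂ)).re * (iteratedDeriv j f ((footL T b : ℝ) : ℂ)).re ∨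
      (iteratedDeriv (j + 1) f ((footR T b : ℝ) : ℂ)).re * (iteratedDeriv j f ((footR T b : ℝ) : ℂ)).re ≤ 0 := by
  obtain ⟨hrL, hrR⟩ := feet_in_range hE hT hbT htouch hcorner
  rcases unionShadow_trichotomy b hE hT hnR hrL hrR with ⟨t, ht, ht0⟩ | hL | hR
  · by_cases hnear : |t - T.re| ≤ T.im / 2
    · exact Or.inl ⟨t, ht0, hnear⟩
    · exact Or.inr (Or.inl ⟨t, ht, ht0, lt_of_not_ge hnear⟩)
  · exact Or.inr (Or.inr (Or.inl hL))
  · exact Or.inr (Or.inr (Or.inr hR))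

/-- (K) The same dispatch read off the 2′ datum `RhW08.Lens1PinningTol.UmbrellaLow θ` (#1256): its tallest band state `T` and pinned
out-of-band partner `b` in the θ-band feed `umbrella_dispatch` directly (only `Im b ≤ Im T` and the touching are used — valid for every
`θ`; the band lower edge is passed through and `PinnedTopAt f j b` rides along unused). -/
theorem umbrellaLow_dispatch {θ η : ℝ} {f : ℂ → ℂ} {x₀ s hmax R Hs : ℝ} {B j : ℕ} {v : ℂ}
    (hE : EngineHyps5 2 η f x₀ s hmax R Hs B) (hnR : ¬ ReadyR2 η f x₀ s hmax R Hs B j v)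
    (hcorner : Real.sqrt j * Hs + 3 * Hs < ((j : ℝ) + 2) * R / 2)
    (hU : RhW08.Lens1PinningTol.UmbrellaLow θ η f x₀ s hmax R Hs B j) :
    ∃ T b : ℂ, StTrkDQ η f x₀ s hmax R Hs B j T ∧ iteratedDeriv j f b = 0 ∧ (1 - θ) * T.im ≤ b.im ∧ b.im ≤ T.im ∧
      |T.re - b.re| ≤ T.im + b.im ∧
      ((∃ t : ℝ, iteratedDeriv j f (t : ℂ) = 0 ∧ |t - T.re| ≤ T.im / 2) ∨
        (∃ t ∈ Icc (footL T b) (footR T b), iteratedDeriv j f (t : ℂ) = 0 ∧ T.im / 2 < |t - T.re|) ∨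
        0 ≤ (iteratedDeriv (j + 1) f ((footL T b : ℝ) : ℂ)).re * (iteratedDeriv j f ((footL T b : ℝ) : ℂ)).re ∨
        (iteratedDeriv (j + 1) f ((footR T b : ℝ) : ℂ)).re * (iteratedDeriv j f ((footR T b : ℝ) : ℂ)).re ≤ 0) := by
  obtain ⟨T, b, hT, -, hb0, hb1, hb2, htouch, -, -⟩ := hU
  exact ⟨T, b, hT, hb0, hb1, hb2, htouch, umbrella_dispatch b hE hT hnR hb2 htouch hcorner⟩

/-! ## §4 (K) n1 — the rest factor exists (tenure (23) n1; C2 RESULT-6 (β): K, all ingredients in the import closure by name) -/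

/-- (K) one peeling step: an entire `F` vanishing at `v` is `(z − v)·G` with `G = dslope F v` entire. -/
theorem peel {F : ℂ → ℂ} (hF : Differentiable ℂ F) {v : ℂ} (hv : F v = 0) :
    ∃ G : ℂ → ℂ, Differentiable ℂ G ∧ ∀ z, F z = (z - v) * G z :=
  ⟨dslope F v, Literature.NumberTheory.LFunctions.BurnolVectors.differentiable_dslope hF v,
    fun z => RhW08.NewtonDoor.factor_dslope hv z⟩

/-- ★ (K) n1 `restFactor_of_zeros`: on a legal frame, zeros `T` (upper), `b` (upper, `b ≠ T`) and a real zero `t` of `f⁽ʲ⁾` give an entire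
rest factor `H` with `f⁽ʲ⁾ = (z − T)(z − T̄)(z − b)(z − b̄)(z − t)·H` — the hypothesis `RestFactor` of (N″a) is free in 2′ (`T` a band state and
`b` not one force `b ≠ T`).  Conjugate zeros from the frame's realness; five `dslope` peelings; no growth bookkeeping (existence only). -/
theorem restFactor_of_zeros {η : ℝ} {f : ℂ → ℂ} {x₀ s hmax R Hs : ℝ} {B : ℕ} (hE : EngineHyps5 2 η f x₀ s hmax R Hs B) (j : ℕ)
    {T b : ℂ} {t : ℝ} (hT : iteratedDeriv j f T = 0) (hb : iteratedDeriv j f b = 0) (ht : iteratedDeriv j f (t : ℂ) = 0)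
    (hTim : 0 < T.im) (hbim : 0 < b.im) (hbT : b ≠ T) : ∃ H : ℂ → ℂ, RestFactor f j T b t H := by
  set F : ℂ → ℂ := iteratedDeriv j f with hFdef
  have hFd : Differentiable ℂ F := Literature.Analysis.Complex.differentiable_iteratedDeriv_of_entire hE.1 j
  have hconj : ∀ z : ℂ, F (conj z) = conj (F z) := fun z =>
    Literature.NumberTheory.LFunctions.iteratedDeriv_conj_of_conj (Literature.Analysis.Complex.apply_conj_eq_conj hE.1 hE.2.1) j z
  have hFcT : F (conj T) = 0 := by rw [hconj, show F T = 0 from hT, map_zero]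
  have hFcb : F (conj b) = 0 := by rw [hconj, show F b = 0 from hb, map_zero]
  -- the distinctness list (signs of imaginary parts + `b ≠ T`)
  have hcT_T : conj T ≠ T := fun h => by have := congrArg Complex.im h; simp at this; linarith
  have hb_cT : b ≠ conj T := fun h => by have := congrArg Complex.im h; simp at this; linarith
  have hcb_T : conj b ≠ T := fun h => by have := congrArg Complex.im h; simp at this; linarith
  have hcb_cT : conj b ≠ conj T := fun h => hbT (by simpa using congrArg conj h)
  have hcb_b : conj b ≠ b := fun h => by have := congrArg Complex.im h; simp at this; linarith
  have ht_T : (t : ℂ) ≠ T := fun h => by have := congrArg Complex.im h; simp at this; linarith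
  have ht_cT : (t : ℂ) ≠ conj T := fun h => by have := congrArg Complex.im h; simp at this; linarith
  have ht_b : (t : ℂ) ≠ b := fun h => by have := congrArg Complex.im h; simp at this; linarith
  have ht_cb : (t : ℂ) ≠ conj b := fun h => by have := congrArg Complex.im h; simp at this; linarith
  -- five peelings: T, T̄, b, b̄, t
  obtain ⟨F₁, hF₁d, hF₁⟩ := peel hFd (show F T = 0 from hT)
  have hF₁cT : F₁ (conj T) = 0 := by
    have h := hF₁ (conj T); rw [hFcT] at h
    exact (mul_eq_zero.1 h.symm).resolve_left (sub_ne_zero.2 hcT_T)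
  obtain ⟨F₂, hF₂d, hF₂⟩ := peel hF₁d hF₁cT
  have hF₂b : F₂ b = 0 := by
    have h := hF₁ b; rw [show F b = 0 from hb, hF₂ b] at h
    rcases mul_eq_zero.1 h.symm with h1 | h1
    · exact absurd (sub_eq_zero.1 h1) hbT
    · exact (mul_eq_zero.1 h1).resolve_left (sub_ne_zero.2 hb_cT)
  obtain ⟨F₃, hF₃d, hF₃⟩ := peel hF₂d hF₂b
  have hF₃cb : F₃ (conj b) = 0 := by
    have h := hF₁ (conj b); rw [hFcb, hF₂, hF₃] at h
    rcases mul_eq_zero.1 h.symm with h1 | h1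
    · exact absurd (sub_eq_zero.1 h1) hcb_T
    · rcases mul_eq_zero.1 h1 with h2 | h2
      · exact absurd (sub_eq_zero.1 h2) hcb_cT
      · exact (mul_eq_zero.1 h2).resolve_left (sub_ne_zero.2 hcb_b)
  obtain ⟨F₄, hF₄d, hF₄⟩ := peel hF₃d hF₃cb
  have hF₄t : F₄ t = 0 := by
    have h := hF₁ t; rw [show F t = 0 from ht, hF₂, hF₃, hF₄] at h
    rcases mul_eq_zero.1 h.symm with h1 | h1
    · exact absurd (sub_eq_zero.1 h1) ht_T
    · rcases mul_eq_zero.1 h1 with h2 | h2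
      · exact absurd (sub_eq_zero.1 h2) ht_cT
      · rcases mul_eq_zero.1 h2 with h3 | h3
        · exact absurd (sub_eq_zero.1 h3) ht_b
        · exact (mul_eq_zero.1 h3).resolve_left (sub_ne_zero.2 ht_cb)
  obtain ⟨H, hHd, hH⟩ := peel hF₄d hF₄t
  refine ⟨H, hHd, fun z => ?_⟩
  show F z = _
  rw [hF₁ z, hF₂ z, hF₃ z, hF₄ z, hH z]; ring

end RhW08.Lens1ToothNestUmbrella
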